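import Summits.CriticalPhenomena.PercolationContinuityZ3.Theorems.PercNearOneGluingNoHeavyLowerTailFourPointExchangeB
import Summits.CriticalPhenomena.PercolationContinuityZ3.Theorems.PercNearOneGluingNoHeavyLowerTailSwitchRelaxIncDictionary2
import Summits.CriticalPhenomena.PercolationContinuityZ3.Theorems.PercNearOneGluingNoHeavyLowerTailSwitchRelaxK4R4Measure
import Summits.CriticalPhenomena.PercolationContinuityZ3.Theorems.PercNearOneGluingNoHeavyLowerTailL1CertDict
import Summits.CriticalPhenomena.PercolationContinuityZ3.Theorems.PercNearOneGluingNoHeavyLowerTailSwitchRelaxFinc24Measure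

/-!
# Four-point exchange inequalities, types E and F0 (all `n`)

Support file for crux `stmt-CriticalPhenomena-4575` (master-family programme, row `Q44`, single-source packing; MONO-A
line), seat `prim-bnk-1` gen 33; memo `run/shared/lean/prim/prim-l12/FROM-prim-bnk-1-gen33-LAW-LEVEL-MONO-A.md` header (4) / §6.

The atlas of all single-cell product inequalities `μ(p)μ(q) ≤ μ(p')μ(q')` between four-point connectivity cells that hold on
every weighted graph (memo header (4); cells numbered as `FourPointAtoms.pat4`:
`0 a|b|c|y, 1 a|b|cy, 2 a|by|c, 3 a|bc|y, 4 ay|b|c, 5 ac|b|y, 6 ab|c|y, 7 a|bcy, 8 ay|bc, 9 ac|by, 10 acy|b, 11 ab|cy, 12 aby|c, 13 abc|y, 14 abcy`).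
Types B and D are `…FourPointExchangeB/D`, types F1 and G `…FourPointExchangeG`; here the pure-Harris members
(event-level Harris lemmas `harris_inc_inc/_inc_dec/_dec_dec` for `prodBernoulli` from `BHK2006.harris`):
* `typeE_cell` : `cell 6 · cell 10 ≤ cell 0 · cell 14` (`μ(ab|c|y)μ(acy|b) ≤ μ(⊥)μ(abcy)`; four Harris inequalities);
* `typeF0_cell`: `cell 11 · cell 9 ≤ cell 0 · cell 14` (`μ(ab|cy)μ(ac|by) ≤ μ(⊥)μ(abcy)`; four Harris inequalities — the
  shape of the Harris proof of the K5 sub-law, memo §4b).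
All hold for all marked points.  No named facts, no sorries, no definitions.
-/

noncomputable section

namespace Summit.CriticalPhenomena.PercolationContinuityZ3.Theorems

namespace FourPointExchange

open MeasureTheory Set Literature.Probability.Percolation Literature.Probability.Percolation.BHK2006
open Literature.Probability.LatticeModels (prodBernoulli)
open DecisionTree (ind ind_of_mem ind_of_not_mem ind_nonneg)
open CondHarris FourPointAtoms
open Summit.CriticalPhenomena.PercolationContinuityZ3.Cruxes.AdditiveGluing.TieLine.ConnAtoms
open scoped Classical

variable {V : Type*}

/-- The indicator of an up-closed event is monotone. [folklore] -/
theorem ind_monotone_of_upClosed {E : Set (Set (Sym2 V))} (hE : ∀ ⦃ω ω' : Set (Sym2 V)⦄, ω ⊆ ω' → ω ∈ E → ω' ∈ E) :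
    Monotone (ind E) := by
  intro ω ω' h
  by_cases hω : ω ∈ E
  · rw [ind_of_mem hω, ind_of_mem (hE h hω)]
  · rw [ind_of_not_mem hω]; exact ind_nonneg _ _

/-- The indicator of a down-closed event is antitone. [folklore] -/
theorem ind_antitone_of_downClosed {E : Set (Set (Sym2 V))} (hE : ∀ ⦃ω ω' : Set (Sym2 V)⦄, ω ⊆ ω' → ω' ∈ E → ω ∈ E) :
    Antitone (ind E) := by
  intro ω ω' h
  by_cases hω' : ω' ∈ E
  · rw [ind_of_mem hω', ind_of_mem (hE h hω')]
  · rw [ind_of_not_mem hω']; exact ind_nonneg _ _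

omit V in
/-- Reachability is monotone in the configuration. [folklore] -/
theorem reach_mono {W : Type*} {ω ω' : Set (Sym2 W)} (h : ω ⊆ ω') {x z : W} (hr : (openGraph ω).Reachable x z) :
    (openGraph ω').Reachable x z := SimpleGraph.Reachable.mono (openGraph_le h) hr

variable [Fintype V] (w : Sym2 V → unitInterval) (a b c y : V)

/-- **Harris, two increasing events**: `μ(E) μ(F) ≤ μ(E ∩ F)`. [cite: VandenbergHaggstromKahn2005, §1 p. 6 ("Harris' inequality")] -/
theorem harris_inc_inc {E F : Set (Set (Sym2 V))} (hE : Monotone (ind E)) (hF : Monotone (ind F)) :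
    (prodBernoulli w).real E * (prodBernoulli w).real F ≤ (prodBernoulli w).real (E ∩ F) := by
  have h := harris (wr_nonneg w) (wr_le_one w) (fun _ => ind_nonneg E _) (fun _ => ind_nonneg F _) hE hF
  rw [sum_weight_wr w, one_mul] at h
  rw [measureReal_eq_sum, measureReal_eq_sum, measureReal_eq_sum]
  simpa only [BHK2006.ind_inter] using h

/-- **Harris, an increasing and a decreasing event**: `μ(E ∩ N) ≤ μ(E) μ(N)`. [cite: VandenbergHaggstromKahn2005, §1 p. 4, display (4)] -/
theorem harris_inc_dec {E N : Set (Set (Sym2 V))} (hE : Monotone (ind E)) (hN : Antitone (ind N)) :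
    (prodBernoulli w).real (E ∩ N) ≤ (prodBernoulli w).real E * (prodBernoulli w).real N := by
  have h := harris_mono_anti (wr_nonneg w) (wr_le_one w) (sum_weight_wr w) (fun _ => ind_nonneg E _) hE hN
    (fun _ => BHK2006.ind_le_one N _)
  rw [measureReal_eq_sum, measureReal_eq_sum, measureReal_eq_sum]
  simpa only [BHK2006.ind_inter] using h

/-- **Harris, two decreasing events**: `μ(N) μ(N') ≤ μ(N ∩ N')`. [cite: VandenbergHaggstromKahn2005, §1 p. 4, display (4)] -/
theorem harris_dec_dec {N N' : Set (Set (Sym2 V))} (hN : Antitone (ind N)) (hN' : Antitone (ind N')) :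
    (prodBernoulli w).real N * (prodBernoulli w).real N' ≤ (prodBernoulli w).real (N ∩ N') := by
  have h := harris_anti_anti (wr_nonneg w) (wr_le_one w) (sum_weight_wr w) hN hN'
    (fun _ => BHK2006.ind_le_one N _) (fun _ => BHK2006.ind_le_one N' _)
  rw [measureReal_eq_sum, measureReal_eq_sum, measureReal_eq_sum]
  simpa only [BHK2006.ind_inter] using h

/-! ## Type E: `μ(ab|c|y) μ(acy|b) ≤ μ(⊥) μ(abcy)` -/

section dict
/-! Dictionary (events ↦ cells). -/

/-- `μ({c} and {y} isolated from the rest) = c0 + c6`. [this work] -/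
theorem real_isoC_isoY : (prodBernoulli w).real (((openConn c a)ᶜ ∩ (openConn c b)ᶜ ∩ (openConn c y)ᶜ) ∩
      ((openConn y a)ᶜ ∩ (openConn y b)ᶜ)) = cell w a b c y 0 + cell w a b c y 6 := by
  rw [measureReal_eq_cellSum w a b c y (show HasPattern (quad a b c y) (((openConn c a)ᶜ ∩ (openConn c b)ᶜ ∩ (openConn c y)ᶜ) ∩
      ((openConn y a)ᶜ ∩ (openConn y b)ᶜ)) _ from
    ((((oc a b c y 2 0 rfl rfl).compl.inter (oc a b c y 2 1 rfl rfl).compl).inter (oc a b c y 2 3 rfl rfl).compl).inter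
      ((oc a b c y 3 0 rfl rfl).compl.inter (oc a b c y 3 1 rfl rfl).compl)))]
  simp (config := {decide := true}) only [ite_true, ite_false]; ring

/-- `μ({a↔b} ∩ {c, y isolated}) = c6`. [this work] -/
theorem real_ab_isoC_isoY : (prodBernoulli w).real (openConn a b ∩ (((openConn c a)ᶜ ∩ (openConn c b)ᶜ ∩ (openConn c y)ᶜ) ∩
      ((openConn y a)ᶜ ∩ (openConn y b)ᶜ))) = cell w a b c y 6 := by
  rw [measureReal_eq_cellSum w a b c y (show HasPattern (quad a b c y) (openConn a b ∩ (((openConn c a)ᶜ ∩ (openConn c b)ᶜ ∩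
      (openConn c y)ᶜ) ∩ ((openConn y a)ᶜ ∩ (openConn y b)ᶜ))) _ from
    ((oc a b c y 0 1 rfl rfl).inter ((((oc a b c y 2 0 rfl rfl).compl.inter (oc a b c y 2 1 rfl rfl).compl).inter
      (oc a b c y 2 3 rfl rfl).compl).inter ((oc a b c y 3 0 rfl rfl).compl.inter (oc a b c y 3 1 rfl rfl).compl))))]
  simp (config := {decide := true}) only [ite_true, ite_false]; ring

/-- `μ({b} isolated) = c0+c1+c4+c5+c10`. [this work] -/
theorem real_isoB : (prodBernoulli w).real ((openConn b a)ᶜ ∩ (openConn b c)ᶜ ∩ (openConn b y)ᶜ) =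
    cell w a b c y 0 + cell w a b c y 1 + cell w a b c y 4 + cell w a b c y 5 + cell w a b c y 10 := by
  rw [measureReal_eq_cellSum w a b c y (show HasPattern (quad a b c y) ((openConn b a)ᶜ ∩ (openConn b c)ᶜ ∩ (openConn b y)ᶜ) _ from
    (((oc a b c y 1 0 rfl rfl).compl.inter (oc a b c y 1 2 rfl rfl).compl).inter (oc a b c y 1 3 rfl rfl).compl))]
  simp (config := {decide := true}) only [ite_true, ite_false]; ring

/-- `μ({a↔c} ∩ {a↔y} ∩ {b isolated}) = c10`. [this work] -/
theorem real_acy_isoB : (prodBernoulli w).real ((openConn a c ∩ openConn a y) ∩ ((openConn b a)ᶜ ∩ (openConn b c)ᶜ ∩ (openConn b y)ᶜ)) =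
    cell w a b c y 10 := by
  rw [measureReal_eq_cellSum w a b c y (show HasPattern (quad a b c y) ((openConn a c ∩ openConn a y) ∩
      ((openConn b a)ᶜ ∩ (openConn b c)ᶜ ∩ (openConn b y)ᶜ)) _ from
    (((oc a b c y 0 2 rfl rfl).inter (oc a b c y 0 3 rfl rfl)).inter
      (((oc a b c y 1 0 rfl rfl).compl.inter (oc a b c y 1 2 rfl rfl).compl).inter (oc a b c y 1 3 rfl rfl).compl)))]
  simp (config := {decide := true}) only [ite_true, ite_false]; ring

/-- `μ({a↔b} ∩ {a↔c} ∩ {a↔y}) = c14`. [this work] -/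
theorem real_ab_acy : (prodBernoulli w).real (openConn a b ∩ (openConn a c ∩ openConn a y)) = cell w a b c y 14 := by
  rw [measureReal_eq_cellSum w a b c y (show HasPattern (quad a b c y) (openConn a b ∩ (openConn a c ∩ openConn a y)) _ from
    ((oc a b c y 0 1 rfl rfl).inter ((oc a b c y 0 2 rfl rfl).inter (oc a b c y 0 3 rfl rfl))))]
  simp (config := {decide := true}) only [ite_true, ite_false]; ring

/-- `μ({c,y isolated} ∩ {b isolated}) = c0`. [this work] -/
theorem real_iso_all : (prodBernoulli w).real ((((openConn c a)ᶜ ∩ (openConn c b)ᶜ ∩ (openConn c y)ᶜ) ∩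
      ((openConn y a)ᶜ ∩ (openConn y b)ᶜ)) ∩ ((openConn b a)ᶜ ∩ (openConn b c)ᶜ ∩ (openConn b y)ᶜ)) = cell w a b c y 0 := by
  rw [measureReal_eq_cellSum w a b c y (show HasPattern (quad a b c y) ((((openConn c a)ᶜ ∩ (openConn c b)ᶜ ∩ (openConn c y)ᶜ) ∩
      ((openConn y a)ᶜ ∩ (openConn y b)ᶜ)) ∩ ((openConn b a)ᶜ ∩ (openConn b c)ᶜ ∩ (openConn b y)ᶜ)) _ from
    (((((oc a b c y 2 0 rfl rfl).compl.inter (oc a b c y 2 1 rfl rfl).compl).inter (oc a b c y 2 3 rfl rfl).compl).inter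
      ((oc a b c y 3 0 rfl rfl).compl.inter (oc a b c y 3 1 rfl rfl).compl)).inter
      (((oc a b c y 1 0 rfl rfl).compl.inter (oc a b c y 1 2 rfl rfl).compl).inter (oc a b c y 1 3 rfl rfl).compl)))]
  simp (config := {decide := true}) only [ite_true, ite_false]; ring

end dict

/-- **Type E exchange inequality** (all `n`): `μ(ab|c|y)·μ(acy|b) ≤ μ(a|b|c|y)·μ(abcy)` — four Harris inequalities
(`{a↔b}` against `{c,y isolated}`, `{a↔c,a↔y}` against `{b isolated}`, then the increasing and the decreasing pairs).
[this work] -/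
theorem typeE_cell : cell w a b c y 6 * cell w a b c y 10 ≤ cell w a b c y 0 * cell w a b c y 14 := by
  -- monotonicity of the four events
  have hI1 : Monotone (ind (openConn a b)) := ind_openConn_monotone a b
  have hI2 : Monotone (ind (openConn a c ∩ openConn a y)) :=
    ind_monotone_of_upClosed fun ω ω' h hω => ⟨reach_mono h hω.1, reach_mono h hω.2⟩
  have hN1 : Antitone (ind (((openConn c a)ᶜ ∩ (openConn c b)ᶜ ∩ (openConn c y)ᶜ) ∩ ((openConn y a)ᶜ ∩ (openConn y b)ᶜ))) :=
    ind_antitone_of_downClosed fun ω ω' h hω' =>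
      ⟨⟨⟨fun hr => hω'.1.1.1 (reach_mono h hr), fun hr => hω'.1.1.2 (reach_mono h hr)⟩, fun hr => hω'.1.2 (reach_mono h hr)⟩,
        ⟨fun hr => hω'.2.1 (reach_mono h hr), fun hr => hω'.2.2 (reach_mono h hr)⟩⟩
  have hN2 : Antitone (ind ((openConn b a)ᶜ ∩ (openConn b c)ᶜ ∩ (openConn b y)ᶜ)) :=
    ind_antitone_of_downClosed fun ω ω' h hω' =>
      ⟨⟨fun hr => hω'.1.1 (reach_mono h hr), fun hr => hω'.1.2 (reach_mono h hr)⟩, fun hr => hω'.2 (reach_mono h hr)⟩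
  have h1 := harris_inc_dec w hI1 hN1
  have h2 := harris_inc_dec w hI2 hN2
  have h3 := harris_inc_inc w hI1 hI2
  have h4 := harris_dec_dec w hN1 hN2
  rw [real_ab_isoC_isoY, SwitchRelax.Finc24.rE2, real_isoC_isoY] at h1
  rw [real_acy_isoB, FourPointAtoms.real_xCacCay, real_isoB] at h2
  rw [SwitchRelax.Finc24.rE2, FourPointAtoms.real_xCacCay, real_ab_acy] at h3
  rw [real_isoC_isoY, real_isoB, real_iso_all] at h4
  have p1 := cell_nonneg w a b c y 0; have p6 := cell_nonneg w a b c y 6; have p10 := cell_nonneg w a b c y 10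
  have p14 := cell_nonneg w a b c y 14; have p11 := cell_nonneg w a b c y 11; have p12 := cell_nonneg w a b c y 12
  have p13 := cell_nonneg w a b c y 13; have p1' := cell_nonneg w a b c y 1; have p4 := cell_nonneg w a b c y 4
  have p5 := cell_nonneg w a b c y 5
  -- c6 c10 ≤ [P(I1) P(N1)] [P(I2) P(N2)] = [P(I1)P(I2)] [P(N1)P(N2)] ≤ c14 c0
  calc cell w a b c y 6 * cell w a b c y 10
      ≤ ((cell w a b c y 6 + cell w a b c y 11 + cell w a b c y 12 + cell w a b c y 13 + cell w a b c y 14) *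
          (cell w a b c y 0 + cell w a b c y 6)) *
        ((cell w a b c y 10 + cell w a b c y 14) *
          (cell w a b c y 0 + cell w a b c y 1 + cell w a b c y 4 + cell w a b c y 5 + cell w a b c y 10)) :=
        mul_le_mul h1 h2 p10 (by positivity)
    _ = ((cell w a b c y 6 + cell w a b c y 11 + cell w a b c y 12 + cell w a b c y 13 + cell w a b c y 14) *
          (cell w a b c y 10 + cell w a b c y 14)) *
        ((cell w a b c y 0 + cell w a b c y 6) *
          (cell w a b c y 0 + cell w a b c y 1 + cell w a b c y 4 + cell w a b c y 5 + cell w a b c y 10)) := by ring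
    _ ≤ cell w a b c y 14 * cell w a b c y 0 := mul_le_mul h3 h4 (by positivity) p14
    _ = cell w a b c y 0 * cell w a b c y 14 := by ring

/-! ## Type F0: `μ(ab|cy) μ(ac|by) ≤ μ(⊥) μ(abcy)` -/

section dictF
/-- `μ({a,c} ↮ {b,y}) = c0 + c2 + c5 + c9`. [this work] -/
theorem real_sep_ac_by : (prodBernoulli w).real (((openConn a b)ᶜ ∩ (openConn a y)ᶜ) ∩ ((openConn c b)ᶜ ∩ (openConn c y)ᶜ)) =
    cell w a b c y 0 + cell w a b c y 2 + cell w a b c y 5 + cell w a b c y 9 := by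
  rw [measureReal_eq_cellSum w a b c y (show HasPattern (quad a b c y)
      (((openConn a b)ᶜ ∩ (openConn a y)ᶜ) ∩ ((openConn c b)ᶜ ∩ (openConn c y)ᶜ)) _ from
    (((oc a b c y 0 1 rfl rfl).compl.inter (oc a b c y 0 3 rfl rfl).compl).inter
      ((oc a b c y 2 1 rfl rfl).compl.inter (oc a b c y 2 3 rfl rfl).compl)))]
  simp (config := {decide := true}) only [ite_true, ite_false]; ring

/-- `μ(ab|cy) = μ({a↔b}∩{c↔y} ∩ {a,b}↮{c,y}) = c11`. [this work] -/
theorem real_F_11 : (prodBernoulli w).real ((openConn a b ∩ openConn c y) ∩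
      (((openConn a c)ᶜ ∩ (openConn a y)ᶜ) ∩ ((openConn b c)ᶜ ∩ (openConn b y)ᶜ))) = cell w a b c y 11 := by
  rw [measureReal_eq_cellSum w a b c y (show HasPattern (quad a b c y) ((openConn a b ∩ openConn c y) ∩
      (((openConn a c)ᶜ ∩ (openConn a y)ᶜ) ∩ ((openConn b c)ᶜ ∩ (openConn b y)ᶜ))) _ from
    (((oc a b c y 0 1 rfl rfl).inter (oc a b c y 2 3 rfl rfl)).inter
      (((oc a b c y 0 2 rfl rfl).compl.inter (oc a b c y 0 3 rfl rfl).compl).inter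
        ((oc a b c y 1 2 rfl rfl).compl.inter (oc a b c y 1 3 rfl rfl).compl))))]
  simp (config := {decide := true}) only [ite_true, ite_false]; ring

/-- `μ(ac|by) = μ({a↔c}∩{b↔y} ∩ {a,c}↮{b,y}) = c9`. [this work] -/
theorem real_F_9 : (prodBernoulli w).real ((openConn a c ∩ openConn b y) ∩
      (((openConn a b)ᶜ ∩ (openConn a y)ᶜ) ∩ ((openConn c b)ᶜ ∩ (openConn c y)ᶜ))) = cell w a b c y 9 := by
  rw [measureReal_eq_cellSum w a b c y (show HasPattern (quad a b c y) ((openConn a c ∩ openConn b y) ∩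
      (((openConn a b)ᶜ ∩ (openConn a y)ᶜ) ∩ ((openConn c b)ᶜ ∩ (openConn c y)ᶜ))) _ from
    (((oc a b c y 0 2 rfl rfl).inter (oc a b c y 1 3 rfl rfl)).inter
      (((oc a b c y 0 1 rfl rfl).compl.inter (oc a b c y 0 3 rfl rfl).compl).inter
        ((oc a b c y 2 1 rfl rfl).compl.inter (oc a b c y 2 3 rfl rfl).compl))))]
  simp (config := {decide := true}) only [ite_true, ite_false]; ring

/-- `μ({a↔b,c↔y} ∩ {a↔c,b↔y}) = c14`. [this work] -/
theorem real_F_14 : (prodBernoulli w).real ((openConn a b ∩ openConn c y) ∩ (openConn a c ∩ openConn b y)) = cell w a b c y 14 := by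
  rw [measureReal_eq_cellSum w a b c y (show HasPattern (quad a b c y) ((openConn a b ∩ openConn c y) ∩ (openConn a c ∩ openConn b y)) _ from
    (((oc a b c y 0 1 rfl rfl).inter (oc a b c y 2 3 rfl rfl)).inter ((oc a b c y 0 2 rfl rfl).inter (oc a b c y 1 3 rfl rfl))))]
  simp (config := {decide := true}) only [ite_true, ite_false]; ring

/-- `μ(all four separated) = c0` (as the intersection of the two separations). [this work] -/
theorem real_F_0 : (prodBernoulli w).real ((((openConn a c)ᶜ ∩ (openConn a y)ᶜ) ∩ ((openConn b c)ᶜ ∩ (openConn b y)ᶜ)) ∩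
      (((openConn a b)ᶜ ∩ (openConn a y)ᶜ) ∩ ((openConn c b)ᶜ ∩ (openConn c y)ᶜ))) = cell w a b c y 0 := by
  rw [measureReal_eq_cellSum w a b c y (show HasPattern (quad a b c y) ((((openConn a c)ᶜ ∩ (openConn a y)ᶜ) ∩
      ((openConn b c)ᶜ ∩ (openConn b y)ᶜ)) ∩ (((openConn a b)ᶜ ∩ (openConn a y)ᶜ) ∩ ((openConn c b)ᶜ ∩ (openConn c y)ᶜ))) _ from
    ((((oc a b c y 0 2 rfl rfl).compl.inter (oc a b c y 0 3 rfl rfl).compl).inter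
      ((oc a b c y 1 2 rfl rfl).compl.inter (oc a b c y 1 3 rfl rfl).compl)).inter
     (((oc a b c y 0 1 rfl rfl).compl.inter (oc a b c y 0 3 rfl rfl).compl).inter
      ((oc a b c y 2 1 rfl rfl).compl.inter (oc a b c y 2 3 rfl rfl).compl))))]
  simp (config := {decide := true}) only [ite_true, ite_false]; ring

end dictF

/-- **Type F0 exchange inequality** (all `n`): `μ(ab|cy)·μ(ac|by) ≤ μ(a|b|c|y)·μ(abcy)` — four Harris inequalities
(this is also the shape of the Harris proof of the K5 sub-law, memo §4b). [this work] -/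
theorem typeF0_cell : cell w a b c y 11 * cell w a b c y 9 ≤ cell w a b c y 0 * cell w a b c y 14 := by
  have hI1 : Monotone (ind (openConn a b ∩ openConn c y)) :=
    ind_monotone_of_upClosed fun ω ω' h hω => ⟨reach_mono h hω.1, reach_mono h hω.2⟩
  have hI2 : Monotone (ind (openConn a c ∩ openConn b y)) :=
    ind_monotone_of_upClosed fun ω ω' h hω => ⟨reach_mono h hω.1, reach_mono h hω.2⟩
  have hN1 : Antitone (ind (((openConn a c)ᶜ ∩ (openConn a y)ᶜ) ∩ ((openConn b c)ᶜ ∩ (openConn b y)ᶜ))) :=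
    ind_antitone_of_downClosed fun ω ω' h hω' =>
      ⟨⟨fun hr => hω'.1.1 (reach_mono h hr), fun hr => hω'.1.2 (reach_mono h hr)⟩,
        ⟨fun hr => hω'.2.1 (reach_mono h hr), fun hr => hω'.2.2 (reach_mono h hr)⟩⟩
  have hN2 : Antitone (ind (((openConn a b)ᶜ ∩ (openConn a y)ᶜ) ∩ ((openConn c b)ᶜ ∩ (openConn c y)ᶜ))) :=
    ind_antitone_of_downClosed fun ω ω' h hω' =>
      ⟨⟨fun hr => hω'.1.1 (reach_mono h hr), fun hr => hω'.1.2 (reach_mono h hr)⟩,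
        ⟨fun hr => hω'.2.1 (reach_mono h hr), fun hr => hω'.2.2 (reach_mono h hr)⟩⟩
  have hsep : (prodBernoulli w).real (((openConn a c)ᶜ ∩ (openConn a y)ᶜ) ∩ ((openConn b c)ᶜ ∩ (openConn b y)ᶜ)) =
      cell w a b c y 0 + cell w a b c y 1 + cell w a b c y 6 + cell w a b c y 11 := by
    rw [measureReal_eq_cellSum w a b c y (show HasPattern (quad a b c y)
        (((openConn a c)ᶜ ∩ (openConn a y)ᶜ) ∩ ((openConn b c)ᶜ ∩ (openConn b y)ᶜ)) _ from
      (((oc a b c y 0 2 rfl rfl).compl.inter (oc a b c y 0 3 rfl rfl).compl).inter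
        ((oc a b c y 1 2 rfl rfl).compl.inter (oc a b c y 1 3 rfl rfl).compl)))]
    simp (config := {decide := true}) only [ite_true, ite_false]; ring
  have h1 := harris_inc_dec w hI1 hN1
  have h2 := harris_inc_dec w hI2 hN2
  have h3 := harris_inc_inc w hI1 hI2
  have h4 := harris_dec_dec w hN1 hN2
  rw [real_F_11, SwitchRelax.K4R4.rE1, hsep] at h1
  rw [real_F_9, SwitchRelax.IncDict.d54, real_sep_ac_by] at h2
  rw [SwitchRelax.K4R4.rE1, SwitchRelax.IncDict.d54, real_F_14] at h3
  rw [hsep, real_sep_ac_by, real_F_0] at h4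
  have p0 := cell_nonneg w a b c y 0; have p1 := cell_nonneg w a b c y 1; have p2 := cell_nonneg w a b c y 2
  have p5 := cell_nonneg w a b c y 5; have p6 := cell_nonneg w a b c y 6; have p9 := cell_nonneg w a b c y 9
  have p11 := cell_nonneg w a b c y 11; have p14 := cell_nonneg w a b c y 14
  calc cell w a b c y 11 * cell w a b c y 9
      ≤ ((cell w a b c y 11 + cell w a b c y 14) * (cell w a b c y 0 + cell w a b c y 1 + cell w a b c y 6 + cell w a b c y 11)) *
        ((cell w a b c y 9 + cell w a b c y 14) * (cell w a b c y 0 + cell w a b c y 2 + cell w a b c y 5 + cell w a b c y 9)) :=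
        mul_le_mul h1 h2 p9 (by positivity)
    _ = ((cell w a b c y 11 + cell w a b c y 14) * (cell w a b c y 9 + cell w a b c y 14)) *
        ((cell w a b c y 0 + cell w a b c y 1 + cell w a b c y 6 + cell w a b c y 11) *
          (cell w a b c y 0 + cell w a b c y 2 + cell w a b c y 5 + cell w a b c y 9)) := by ring
    _ ≤ cell w a b c y 14 * cell w a b c y 0 := mul_le_mul h3 h4 (by positivity) p14
    _ = cell w a b c y 0 * cell w a b c y 14 := by ring

end FourPointExchange

end Summit.CriticalPhenomena.PercolationContinuityZ3.Theorems
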